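import Summits.Ventures.HodgeRepro.Night4ReducedDimSix

/-!
# The reduced dimension `dim B_red` of every census face of degree 8 — on the kernel, I: `C8`, `Q8`, `D4`

Blind re-derivation cell `pub-hodge-repro`, seat `night-4` (ROUTE HARDENING for the Monday FINAL, gen 4).  Target tree
path `lean/Summits/Ventures/HodgeRepro/Night4ReducedDimEight.lean`.

`route/ROUTE.md` (v2.89) §3.3 «Degree 8 — 21 twist classes, all OPEN as abstract classes …, dim B_red 6–8» lists, per
group of order 8 and central involution `c` (the lead's enumeration + p1's engine): «C8: … two non-isogenous simple CM
fourfolds [4+4]. Q8: 3 classes, 4+4. … D4: 5 classes — 2+2+2 (three CM surfaces) ×4, 2+2+2+2 (dim 8) ×1; a Galois D4 CM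
field carries no primitive type (every CM type is right-invariant under one of the four reflections, hence induced from a
non-Galois quartic CM subfield — ROUTE-B B2; lead's parity proof in Appendix A2)».  Gen 1 put the degree-6 count on the
kernel (`Night4ReducedDimSix.redDim_faceCorners_C6`, `decide +kernel`); the degree-8 count was left there as «needs a
decide that stays under the default heartbeats — a per-CM-type split».  This file does it for the three groups of order 8
with ONE central involution, with the cell's landed vocabulary (`redDim`, `simpleDim`, `faceCorners`, `place`):

* `redDim_faceCorners_of_reps` — the reduction to PLACE REPRESENTATIVES: a face `(Φ; p, p′)` depends on `p`, `p′` only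
  through their places (`flipAt c (c p) = flipAt c p`), so a property of `redDim (faceCorners c Φ p p′)` checked for
  `p`, `p′` in a list of representatives covering every place holds for all `p`, `p′` (this is what keeps every `decide`
  under the default heartbeats: 16 types × 12 ordered pairs per `(G, c)`);
* `redDim_faceCorners_C8 = 8`, `redDim_faceCorners_Q8 = 8`, `redDim_faceCorners_D4 = 6 ∨ = 8` — KERNEL
  (`decide +kernel` over the representatives), for EVERY CM type and every pair of distinct places;
* the values are attained: explicit witnesses `redDim_faceCorners_D4_six` / `_eight`, `…_C8_eight`, `…_Q8_eight`;
* the corner dimensions: `simpleDim_C8 = 4` and `simpleDim_Q8 = 4` (every CM type primitive), `simpleDim_D4 = 2`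
  (no primitive type: every CM type of `D4` has right stabiliser of order 2 — the route's parity statement, KERNEL);
* the same on the roster's face of the product datum (`Route.redDim_prodDatum_faceCorners_*`), as gen 1 did in degree 6.

Part II (`Night4ReducedDimEightAbelian.lean`) does `C4 × C2` (three involutions) and `C2 × C2 × C2`.  What this does NOT
do: the transport to an ABSTRACT group of order 8 (p6's `classify8` is not landed) and the identification
`dim (reduced A Δ) = redDim` (the cell's dictionary `DimReduced`, `Night4ReducedDimRoute`).  Nothing here says anything
about the status of the Hodge conjecture for CM abelian varieties, which is NOT proved.
-/

set_option autoImplicit false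

open Finset

namespace HodgeRepro

/-! ## Reduction to place representatives -/

section Reps

variable {G : Type} [Group G] [DecidableEq G]

/-- A place is unchanged by conjugating its representative: `place c (c p) = place c p`. -/
theorem place_conj_mul {c : G} (hc : IsComplexConj c) (p : G) : place c (c * p) = place c p := by
  simp only [place, hc.mul_mul_cancel]
  exact Finset.pair_comm _ _

/-- A flip at `c p` is the flip at `p`. -/
theorem flipAt_conj_mul {c : G} (hc : IsComplexConj c) (p : G) (S : Finset G) :
    flipAt c (c * p) S = flipAt c p S := by
  unfold flipAt
  rw [place_conj_mul hc]

/-- The face `(Φ; p, p′)` depends on `p` only through its place. -/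
theorem faceCorners_conj_mul_left {c : G} (hc : IsComplexConj c) (Φ : Finset G) (p p' : G) :
    faceCorners c Φ (c * p) p' = faceCorners c Φ p p' := by
  funext i
  fin_cases i <;> simp [faceCorners, flipAt_conj_mul hc]

/-- The face `(Φ; p, p′)` depends on `p′` only through its place. -/
theorem faceCorners_conj_mul_right {c : G} (hc : IsComplexConj c) (Φ : Finset G) (p p' : G) :
    faceCorners c Φ p (c * p') = faceCorners c Φ p p' := by
  funext i
  fin_cases i <;> simp [faceCorners, flipAt_conj_mul hc]

variable [Fintype G]

/-- **Reduction to representatives.**  If a list `reps` meets every place (every `p` is `r` or `c r` for some `r ∈ reps`)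
and a property `P` of `redDim (faceCorners c Φ p p′)` holds for all `p, p′ ∈ reps` in distinct places, then it holds
for all `p, p′` in distinct places. -/
theorem redDim_faceCorners_of_reps {c : G} (hc : IsComplexConj c) (reps : List G)
    (hcover : ∀ p : G, ∃ r ∈ reps, r = p ∨ c * r = p) (P : ℕ → Prop) (Φ : Finset G)
    (h : ∀ p ∈ reps, ∀ p' ∈ reps, p' ∉ place c p → P (redDim (faceCorners c Φ p p')))
    (p p' : G) (hp : p' ∉ place c p) : P (redDim (faceCorners c Φ p p')) := by
  obtain ⟨r, hr, hpr⟩ := hcover p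
  obtain ⟨r', hr', hpr'⟩ := hcover p'
  rcases hpr with rfl | rfl <;> rcases hpr' with rfl | rfl
  · exact h r hr r' hr' hp
  · rw [faceCorners_conj_mul_right hc]
    exact h r hr r' hr' fun hm => hp ((conj_mem_place_iff hc).2 hm)
  · rw [faceCorners_conj_mul_left hc]
    rw [place_conj_mul hc] at hp
    exact h r hr r' hr' hp
  · rw [faceCorners_conj_mul_left hc, faceCorners_conj_mul_right hc]
    rw [place_conj_mul hc] at hp
    exact h r hr r' hr' fun hm => hp ((conj_mem_place_iff hc).2 hm)

end Reps

/-! ## `C8` — every face has `dim B_red = 8` (two non-isogenous simple CM fourfolds) -/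

/-- Representatives of the four places of `(C8, cc_C8)`. -/
def night4Reps_C8 : List C8 :=
  [Multiplicative.ofAdd 0, Multiplicative.ofAdd 1, Multiplicative.ofAdd 2, Multiplicative.ofAdd 3]

/-- `night4Reps_C8` meets every place. -/
theorem night4Reps_C8_cover : ∀ p : C8, ∃ r ∈ night4Reps_C8, r = p ∨ cc_C8 * r = p := by decide

/-- The count on the representatives (KERNEL: the 16 CM types × 12 ordered pairs of representatives in distinct places). -/
theorem redDim_faceCorners_C8_reps : ∀ Φ ∈ cmTypes cc_C8,
    ∀ p ∈ night4Reps_C8, ∀ p' ∈ night4Reps_C8, p' ∉ place cc_C8 p → redDim (faceCorners cc_C8 Φ p p') = 8 := by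
  decide +kernel

/-- **Every census face of the cyclic octic CM field has `dim B_red = 8`** (ROUTE.md §3.3: `C8` — «two non-isogenous
simple CM fourfolds»; §3.5 (i): «the eightfolds A₁ × A₂ (C8, Q8)»).  KERNEL. -/
theorem redDim_faceCorners_C8 (Φ : Finset C8) (p p' : C8) (hΦ : IsCMType cc_C8 Φ) (hp : p' ∉ place cc_C8 p) :
    redDim (faceCorners cc_C8 Φ p p') = 8 :=
  redDim_faceCorners_of_reps cc_C8_isComplexConj night4Reps_C8 night4Reps_C8_cover (· = 8) Φ
    (redDim_faceCorners_C8_reps Φ (mem_cmTypes.2 hΦ)) p p' hp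

/-- The value 8 is attained (a witness face). -/
theorem redDim_faceCorners_C8_eight : ∃ (Φ : Finset C8) (p p' : C8), IsCMType cc_C8 Φ ∧ p' ∉ place cc_C8 p ∧
    redDim (faceCorners cc_C8 Φ p p') = 8 :=
  ⟨{Multiplicative.ofAdd 4, Multiplicative.ofAdd 5, Multiplicative.ofAdd 6, Multiplicative.ofAdd 7},
    Multiplicative.ofAdd 0, Multiplicative.ofAdd 1, by decide, by decide, by decide +kernel⟩

/-- Every CM type of `(C8, cc_C8)` is primitive: its corner is a simple CM fourfold (`simpleDim = 4`; every non-trivial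
subgroup of `C8` contains the conjugation).  KERNEL. -/
theorem simpleDim_C8 : ∀ Φ : Finset C8, IsCMType cc_C8 Φ → simpleDim Φ = 4 := by
  decide +kernel

/-! ## `Q8` — every face has `dim B_red = 8` -/

/-- Representatives of the four places of `(Q8, cc_Q8)`. -/
def night4Reps_Q8 : List Q8 :=
  [QuaternionGroup.a 0, QuaternionGroup.a 1, QuaternionGroup.xa 0, QuaternionGroup.xa 1]

/-- `night4Reps_Q8` meets every place. -/
theorem night4Reps_Q8_cover : ∀ p : Q8, ∃ r ∈ night4Reps_Q8, r = p ∨ cc_Q8 * r = p := by decide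

/-- The count on the representatives (KERNEL). -/
theorem redDim_faceCorners_Q8_reps : ∀ Φ ∈ cmTypes cc_Q8,
    ∀ p ∈ night4Reps_Q8, ∀ p' ∈ night4Reps_Q8, p' ∉ place cc_Q8 p → redDim (faceCorners cc_Q8 Φ p p') = 8 := by
  decide +kernel

/-- **Every census face of a quaternion octic CM field has `dim B_red = 8`** (ROUTE.md §3.3: «Q8: 3 classes, 4+4»).
KERNEL. -/
theorem redDim_faceCorners_Q8 (Φ : Finset Q8) (p p' : Q8) (hΦ : IsCMType cc_Q8 Φ) (hp : p' ∉ place cc_Q8 p) :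
    redDim (faceCorners cc_Q8 Φ p p') = 8 :=
  redDim_faceCorners_of_reps cc_Q8_isComplexConj night4Reps_Q8 night4Reps_Q8_cover (· = 8) Φ
    (redDim_faceCorners_Q8_reps Φ (mem_cmTypes.2 hΦ)) p p' hp

/-- The value 8 is attained (a witness face). -/
theorem redDim_faceCorners_Q8_eight : ∃ (Φ : Finset Q8) (p p' : Q8), IsCMType cc_Q8 Φ ∧ p' ∉ place cc_Q8 p ∧
    redDim (faceCorners cc_Q8 Φ p p') = 8 :=
  ⟨{QuaternionGroup.a 2, QuaternionGroup.a 3, QuaternionGroup.xa 2, QuaternionGroup.xa 3},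
    QuaternionGroup.a 0, QuaternionGroup.a 1, by decide, by decide, by decide +kernel⟩

/-- Every CM type of `(Q8, cc_Q8)` is primitive (`simpleDim = 4`; every non-trivial subgroup of `Q8` contains `−1`).
KERNEL. -/
theorem simpleDim_Q8 : ∀ Φ : Finset Q8, IsCMType cc_Q8 Φ → simpleDim Φ = 4 := by
  decide +kernel

/-! ## `D4` — every face has `dim B_red ∈ {6, 8}`, every corner a CM surface -/

/-- Representatives of the four places of `(D4, cc_D4)`. -/
def night4Reps_D4 : List D4 :=
  [DihedralGroup.r 0, DihedralGroup.r 1, DihedralGroup.sr 0, DihedralGroup.sr 1]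

/-- `night4Reps_D4` meets every place. -/
theorem night4Reps_D4_cover : ∀ p : D4, ∃ r ∈ night4Reps_D4, r = p ∨ cc_D4 * r = p := by decide

/-- The count on the representatives (KERNEL). -/
theorem redDim_faceCorners_D4_reps : ∀ Φ ∈ cmTypes cc_D4,
    ∀ p ∈ night4Reps_D4, ∀ p' ∈ night4Reps_D4, p' ∉ place cc_D4 p →
      redDim (faceCorners cc_D4 Φ p p') = 6 ∨ redDim (faceCorners cc_D4 Φ p p') = 8 := by
  decide +kernel

/-- **Every census face of a dihedral octic CM field has `dim B_red = 6` or `8`** (ROUTE.md §3.3: «D4: 5 classes — 2+2+2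
(three CM surfaces) ×4, 2+2+2+2 (dim 8) ×1»).  KERNEL. -/
theorem redDim_faceCorners_D4 (Φ : Finset D4) (p p' : D4) (hΦ : IsCMType cc_D4 Φ) (hp : p' ∉ place cc_D4 p) :
    redDim (faceCorners cc_D4 Φ p p') = 6 ∨ redDim (faceCorners cc_D4 Φ p p') = 8 :=
  redDim_faceCorners_of_reps cc_D4_isComplexConj night4Reps_D4 night4Reps_D4_cover (fun n => n = 6 ∨ n = 8) Φ
    (redDim_faceCorners_D4_reps Φ (mem_cmTypes.2 hΦ)) p p' hp

/-- The value 6 is attained on `D4` (three CM surfaces). -/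
theorem redDim_faceCorners_D4_six : ∃ (Φ : Finset D4) (p p' : D4), IsCMType cc_D4 Φ ∧ p' ∉ place cc_D4 p ∧
    redDim (faceCorners cc_D4 Φ p p') = 6 :=
  ⟨{DihedralGroup.r 2, DihedralGroup.r 3, DihedralGroup.sr 2, DihedralGroup.sr 3},
    DihedralGroup.r 0, DihedralGroup.sr 0, by decide, by decide, by decide +kernel⟩

/-- The value 8 is attained on `D4` (four CM surfaces). -/
theorem redDim_faceCorners_D4_eight : ∃ (Φ : Finset D4) (p p' : D4), IsCMType cc_D4 Φ ∧ p' ∉ place cc_D4 p ∧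
    redDim (faceCorners cc_D4 Φ p p') = 8 :=
  ⟨{DihedralGroup.r 2, DihedralGroup.r 3, DihedralGroup.sr 2, DihedralGroup.sr 3},
    DihedralGroup.r 0, DihedralGroup.r 1, by decide, by decide, by decide +kernel⟩

/-- **No CM type of `(D4, cc_D4)` is primitive**: every one has right stabiliser of order 2, i.e. `simpleDim = 2` — its
corner is the square of a CM surface (ROUTE.md §3.3: «a Galois D4 CM field carries no primitive type (every CM type is
right-invariant under one of the four reflections …)»).  KERNEL. -/
theorem simpleDim_D4 : ∀ Φ : Finset D4, IsCMType cc_D4 Φ → simpleDim Φ = 2 := by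
  decide +kernel

/-! ## The same on the roster's face of the product datum -/

/-- On the product datum of the census face `(Φ; p, p′)` of `C8`, `TypeDatum.redDim diagFour = 8`. -/
theorem Route.redDim_prodDatum_faceCorners_C8 (Φ : Finset C8) (p p' : C8) (hΦ : IsCMType cc_C8 Φ)
    (hp : p' ∉ place cc_C8 p) :
    (Route.TypeDatum.prodDatum cc_C8_isComplexConj (faceCorners cc_C8 Φ p p')
      (isCMType_faceCorners cc_C8_isComplexConj hΦ p p')).redDim Route.diagFour = 8 := by
  rw [Route.TypeDatum.redDim_prodDatum]
  exact redDim_faceCorners_C8 Φ p p' hΦ hp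

/-- On the product datum of the census face `(Φ; p, p′)` of `Q8`, `TypeDatum.redDim diagFour = 8`. -/
theorem Route.redDim_prodDatum_faceCorners_Q8 (Φ : Finset Q8) (p p' : Q8) (hΦ : IsCMType cc_Q8 Φ)
    (hp : p' ∉ place cc_Q8 p) :
    (Route.TypeDatum.prodDatum cc_Q8_isComplexConj (faceCorners cc_Q8 Φ p p')
      (isCMType_faceCorners cc_Q8_isComplexConj hΦ p p')).redDim Route.diagFour = 8 := by
  rw [Route.TypeDatum.redDim_prodDatum]
  exact redDim_faceCorners_Q8 Φ p p' hΦ hp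

/-- On the product datum of the census face `(Φ; p, p′)` of `D4`, `TypeDatum.redDim diagFour ∈ {6, 8}`. -/
theorem Route.redDim_prodDatum_faceCorners_D4 (Φ : Finset D4) (p p' : D4) (hΦ : IsCMType cc_D4 Φ)
    (hp : p' ∉ place cc_D4 p) :
    (Route.TypeDatum.prodDatum cc_D4_isComplexConj (faceCorners cc_D4 Φ p p')
      (isCMType_faceCorners cc_D4_isComplexConj hΦ p p')).redDim Route.diagFour = 6 ∨
    (Route.TypeDatum.prodDatum cc_D4_isComplexConj (faceCorners cc_D4 Φ p p')
      (isCMType_faceCorners cc_D4_isComplexConj hΦ p p')).redDim Route.diagFour = 8 := by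
  rw [Route.TypeDatum.redDim_prodDatum]
  exact redDim_faceCorners_D4 Φ p p' hΦ hp

end HodgeRepro
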